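import Mathlib
import Literature.Computability.Complexity.EncodingFrames
import Literature.Computability.Complexity.DiagPrelims

/-!
# Ranks and dictionaries of a family of bit strings (stub `stub_completeInvariantFP_of_canonicalForm`,
line `canonical-form-completeness`, crux `SymmetryBudget.WindowBarrier`, item stmt-PneNP-2145)

Pure list combinatorics behind the complete invariant for `Bud`-isomorphism. For a family
`a : ℕ → List Bool` of which the first `g` members matter (the attachment vectors of the `g` free
vertices, all of one length `n`):

* `rankFam a g t = #{i < g | ⟦a i⟧ < ⟦a t⟧}` (`⟦·⟧ = bitsToNat`): a CANONICAL renaming of the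
  occurring strings by numbers `≤ g`, injective on distinct strings of equal length
  (`eq_of_rankFam_eq`) and invariant under re-indexing the family by a permutation of `Fin g`
  (`rankFam_perm`);
* `lookupFam a g n r = (ccat_{j<g} [rankFam j = r] · a j) ↾ n`: the string of rank `r` (`ε` if none) —
  the DICTIONARY rank ↦ string (`lookupFam_rankFam`, `lookupFam_of_forall_ne`, `lookupFam_perm`);
* `ccat` bookkeeping: concatenations of pieces that are all `ε` or one fixed `v`.
-/

-- `Summit.PneNP.PneNP.…` duplicates `PneNP` BY DESIGN (single-problem summit).
set_option linter.dupNamespace false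

namespace Summit.PneNP.PneNP.Theorems.CompleteInvariant

open Literature.Computability.Complexity

/-! ### Concatenations of pieces that are empty or one fixed string -/

/-- A concatenation of pieces each of which is `ε` or `v` is a power of `v`. -/
theorem ccat_eq_flatten_replicate {p : ℕ → List Bool} {v : List Bool} (hv : v ≠ []) :
    ∀ {k : ℕ}, (∀ j, j < k → p j = [] ∨ p j = v) →
      ccat p k = (List.replicate (((Finset.range k).filter fun j => p j ≠ []).card) v).flatten
  | 0, _ => by simp
  | k + 1, h => by
    rw [ccat_succ, ccat_eq_flatten_replicate hv (fun j hj => h j (by omega)), Finset.range_add_one,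
      Finset.filter_insert]
    rcases h k (Nat.lt_succ_self k) with hk | hk
    · rw [hk, if_neg (by simp), List.append_nil]
    · rw [if_pos (by rw [hk]; exact hv), Finset.card_insert_of_notMem (by simp), hk,
        List.replicate_succ', List.flatten_append]
      simp

/-- The `|v|`-prefix of a positive power of `v` is `v`. -/
theorem take_flatten_replicate {v : List Bool} {c : ℕ} (hc : c ≠ 0) :
    ((List.replicate c v).flatten).take v.length = v := by
  obtain ⟨c, rfl⟩ := Nat.exists_eq_succ_of_ne_zero hc
  rw [List.replicate_succ, List.flatten_cons, List.take_left]

/-- **A concatenation of pieces that are all `ε` or `v`, one of which is `v`, begins with `v`.** -/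
theorem take_ccat_eq {p : ℕ → List Bool} {v : List Bool} {k : ℕ} (h : ∀ j, j < k → p j = [] ∨ p j = v)
    {t : ℕ} (ht : t < k) (hpt : p t = v) : (ccat p k).take v.length = v := by
  by_cases hv : v = []
  · subst hv; simp
  · rw [ccat_eq_flatten_replicate hv h]
    refine take_flatten_replicate (Finset.card_ne_zero.2 ⟨t, ?_⟩)
    simp [ht, hpt, hv]

/-- A concatenation of empty pieces is empty. -/
theorem ccat_eq_nil {p : ℕ → List Bool} : ∀ {k : ℕ}, (∀ j, j < k → p j = []) → ccat p k = []
  | 0, _ => rfl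
  | k + 1, h => by rw [ccat_succ, ccat_eq_nil (fun j hj => h j (by omega)), h k (by omega)]; rfl

/-! ### Ranks -/

/-- **The rank** of member `t` of the family `a` among its first `g` members: the number of `i < g`
with `⟦a i⟧ < ⟦a t⟧` (binary values, least significant bit first). -/
def rankFam (a : ℕ → List Bool) (g t : ℕ) : ℕ :=
  ((Finset.range g).filter fun i => bitsToNat (a i) < bitsToNat (a t)).card

/-- The rank is at most `g`. -/
theorem rankFam_le (a : ℕ → List Bool) (g t : ℕ) : rankFam a g t ≤ g :=
  (Finset.card_filter_le _ _).trans (by simp)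

/-- The rank of a member below `g` is below `g` (the member itself is not counted). -/
theorem rankFam_lt {a : ℕ → List Bool} {g t : ℕ} (ht : t < g) : rankFam a g t < g := by
  unfold rankFam
  calc ((Finset.range g).filter fun i => bitsToNat (a i) < bitsToNat (a t)).card
      < (Finset.range g).card := by
        apply Finset.card_lt_card
        refine ⟨Finset.filter_subset _ _, fun hsub => ?_⟩
        have := hsub (Finset.mem_range.2 ht)
        simp at this
    _ = g := Finset.card_range g

/-- Equal strings have equal ranks. -/
theorem rankFam_congr {a : ℕ → List Bool} (g : ℕ) {t t' : ℕ} (h : a t = a t') :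
    rankFam a g t = rankFam a g t' := by
  simp [rankFam, h]

/-- A strictly smaller value has a strictly smaller rank (for members below `g`). -/
theorem rankFam_lt_of_lt {a : ℕ → List Bool} {g t t' : ℕ} (ht : t < g)
    (h : bitsToNat (a t) < bitsToNat (a t')) : rankFam a g t < rankFam a g t' := by
  apply Finset.card_lt_card
  refine ⟨fun i hi => ?_, fun hsub => ?_⟩
  · simp only [Finset.mem_filter] at hi ⊢
    exact ⟨hi.1, hi.2.trans h⟩
  · have : t ∈ (Finset.range g).filter fun i => bitsToNat (a i) < bitsToNat (a t) :=
      hsub (by simp [ht, h])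
    simp at this

/-- **Ranks are injective on distinct strings of equal length.** -/
theorem eq_of_rankFam_eq {a : ℕ → List Bool} {g n t t' : ℕ} (hlen : ∀ i, i < g → (a i).length = n)
    (ht : t < g) (ht' : t' < g) (h : rankFam a g t = rankFam a g t') : a t = a t' := by
  by_contra hne
  have hv : bitsToNat (a t) ≠ bitsToNat (a t') := fun e =>
    hne (DiagPrelims.eq_of_bitsToNat_eq (by rw [hlen t ht, hlen t' ht']) e)
  rcases Nat.lt_or_gt_of_ne hv with hlt | hgt
  · exact absurd h (rankFam_lt_of_lt ht hlt).ne
  · exact absurd h (rankFam_lt_of_lt ht' hgt).ne'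

/-- **Ranks are invariant under re-indexing by a permutation of `Fin g`.** -/
theorem rankFam_perm {a b : ℕ → List Bool} {g : ℕ} (σ : Equiv.Perm (Fin g))
    (h : ∀ j : Fin g, b (σ j) = a j) (j : Fin g) : rankFam b g (σ j) = rankFam a g j := by
  unfold rankFam
  rw [h j]
  symm
  refine Finset.card_bij' (fun i hi => ((σ ⟨i, by simpa using (Finset.mem_filter.1 hi).1⟩ : Fin g) : ℕ))
    (fun i hi => ((σ.symm ⟨i, by simpa using (Finset.mem_filter.1 hi).1⟩ : Fin g) : ℕ))
    (fun i hi => ?_) (fun i hi => ?_) (fun i hi => ?_) (fun i hi => ?_)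
  · simp only [Finset.mem_filter, Finset.mem_range] at hi ⊢
    refine ⟨Fin.is_lt _, ?_⟩
    rw [h ⟨i, hi.1⟩]; exact hi.2
  · simp only [Finset.mem_filter, Finset.mem_range] at hi ⊢
    refine ⟨Fin.is_lt _, ?_⟩
    have := h (σ.symm ⟨i, hi.1⟩)
    rw [Equiv.apply_symm_apply] at this
    rw [← this]; exact hi.2
  · simp
  · simp

/-! ### The dictionary rank ↦ string -/

/-- **The dictionary**: `lookupFam a g n r` is the `n`-prefix of the concatenation, over `j < g`, of
the members `a j` of rank `r` — i.e. THE string of rank `r` when all members have length `n`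
(`lookupFam_rankFam`), and `ε` if no member has rank `r` (`lookupFam_of_forall_ne`). -/
def lookupFam (a : ℕ → List Bool) (g n r : ℕ) : List Bool :=
  (ccat (fun j => if rankFam a g j = r then a j else []) g).take n

/-- **The dictionary returns the string of each occurring rank.** -/
theorem lookupFam_rankFam {a : ℕ → List Bool} {g n t : ℕ} (hlen : ∀ i, i < g → (a i).length = n)
    (ht : t < g) : lookupFam a g n (rankFam a g t) = a t := by
  unfold lookupFam
  rw [← hlen t ht]
  refine take_ccat_eq (fun j hj => ?_) ht (if_pos rfl)
  by_cases hr : rankFam a g j = rankFam a g t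
  · exact Or.inr (by rw [if_pos hr, eq_of_rankFam_eq hlen hj ht hr])
  · exact Or.inl (if_neg hr)

/-- The dictionary is empty at a rank that does not occur. -/
theorem lookupFam_of_forall_ne {a : ℕ → List Bool} {g n r : ℕ} (h : ∀ j, j < g → rankFam a g j ≠ r) :
    lookupFam a g n r = [] := by
  unfold lookupFam
  rw [ccat_eq_nil (fun j hj => if_neg (h j hj)), List.take_nil]

/-- **The dictionary is invariant under re-indexing by a permutation of `Fin g`.** -/
theorem lookupFam_perm {a b : ℕ → List Bool} {g n : ℕ} (σ : Equiv.Perm (Fin g))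
    (h : ∀ j : Fin g, b (σ j) = a j) (hlen : ∀ i, i < g → (a i).length = n) (r : ℕ) :
    lookupFam b g n r = lookupFam a g n r := by
  have hlenb : ∀ i, i < g → (b i).length = n := fun i hi => by
    have := h (σ.symm ⟨i, hi⟩)
    rw [Equiv.apply_symm_apply] at this
    rw [this]; exact hlen _ (Fin.is_lt _)
  by_cases hex : ∃ j, j < g ∧ rankFam a g j = r
  · obtain ⟨j, hj, rfl⟩ := hex
    rw [lookupFam_rankFam hlen hj, ← rankFam_perm σ h ⟨j, hj⟩, lookupFam_rankFam hlenb (Fin.is_lt _), h ⟨j, hj⟩]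
  · push Not at hex
    rw [lookupFam_of_forall_ne hex, lookupFam_of_forall_ne]
    intro i hi hr
    have h1 := rankFam_perm σ h (σ.symm ⟨i, hi⟩)
    rw [Equiv.apply_symm_apply] at h1
    exact hex _ (Fin.is_lt _) (h1.symm.trans hr)


end Summit.PneNP.PneNP.Theorems.CompleteInvariant

namespace Summit.PneNP.PneNP.Theorems

open CompleteInvariant

/-- **Registered sub-goal of S1b (`stub_completeInvariantFP_rankDict`)**: the attachment dictionary returns
the string of each occurring rank (brick file `SymmetryBudgetWindowBarrierRankDict`). -/
theorem stub_completeInvariantFP_rankDict : ∀ (a : ℕ → List Bool) (g n t : ℕ), (∀ i, i < g → (a i).length = n) → t < g → lookupFam a g n (rankFam a g t) = a t :=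
  fun _ _ _ _ hlen ht => lookupFam_rankFam hlen ht

end Summit.PneNP.PneNP.Theorems
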